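import Literature.MathematicalPhysics.QuantumFieldTheory.Balaban1983to89.B6Ineq2123CentredTorus

/-!
# `Balaban1983to89.B6Ineq2127FaceTorus` — T. Bałaban, *Propagators and renormalization transformations for lattice gauge
# theories. II*, Commun. Math. Phys. **96** (1984) 223–250 [Balaban1984PropagatorsII], pp. 244–245, (2.124)–(2.127): THE BONDS
# CROSSING A FACE `b ∈ B(c) = {b : b₋ ∈ B(c₋), b₊ ∈ B(c₊)}` are controlled by `|(Q₁B)(c)|²`, the plaquette variables at the face and the
# bonds inside the two blocks — on the V1 torus calculus (centred blocks), with OUR constants and the face MEAN in place of the printed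
# `(d−1)`-dimensional form `L^{−2}⟨B, (Δ^{L^{−1},N}_{Δ′} + Q′*_{Δ′}Q′_{Δ′})B⟩`

statement-level skeleton of published theorems with citation tags; proofs where landed; nothing here is a claim about the Yang–Mills mass gap

PDF held: `paper:balaban1984-cmp96-propagators-rt-ii` (journal page = PDF page + 222; pp. 244–245 [PDF 22–23] read AS IMAGES on the ×4 renders
`run/shared/lean/pub/pub-balaban/b2b-balaban-ref1/pages/1984-cmp96-propagators-rt-II/…-p022-x4.png`, `…-p023-x4.png`, 2026-08-21).

PRINT (verbatim, pp. 244–245).  *"Next let us consider bonds b ∈ B(c) = {b : b₋ ∈ B(c₋), b₊ ∈ B(c₊)} for some c ∈ Λ′. Let c = ⟨y, y + Le_μ⟩ and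
Δ′, Δ″ denote the intersection of the planes x_μ = c₊,μ − 1 = y_μ + (L − 1), x_μ = c₊,μ = y_μ + L with the blocks B(c₋), B(c₊)
correspondingly … We identify B(b) = B_μ(x) for b = ⟨x, x + e_μ⟩, and we have
Σ_{p⊂B(c)} |(∂₁B)(p)|² ≥ ⅓ Σ_{b⊂Δ′} |(∂B_μ)(b)|² − Σ_{b⊂Δ′} |B(b)|² − Σ_{b⊂Δ″} |B(b)|², (2.124)
|(Q₁B)(c)|² = |Σ_{x∈B(c₋)} L^{−(d+1)} B([x, x + Le_μ])|² = |L^{−d} Σ_{x∈B(y)∖Δ′} L^{−1}(x_μ − y_μ + 1)B_μ(x) + L^{−d} Σ_{x∈Δ′} B_μ(x)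
+ L^{−d} Σ_{x∈B(y+Le_μ)} L^{−1}(2L − 1 + y_μ − x_μ)B_μ(x)|² ≦ [sic] ⅓|Σ_{x∈Δ′} L^{−d}B_μ(x)|² − L^{−d} Σ_{⟨x,x+e_μ⟩⊂B(c₋)} |B_μ(x)|²
− L^{−d} Σ_{⟨x,x+e_μ⟩⊂B(c₊)} |B_μ(x)|². (2.125) From these two inequalities we obtain (2.126) … This quadratic form is bounded from below by
L^{−d−1} Σ_{x∈Δ′} |B_μ(x)|², hence L^{−d} Σ_{p⊂B(c)} |(∂₁B)(p)|² + |(Q₁B)(c)|² ≥ ⅓L^{−d−1} Σ_{b∈B(c)} |B(b)|² − L^{−d} Σ_{b⊂B(c₋)} |B(b)|²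
− L^{−d} Σ_{b⊂B(c₊)} |B(b)|². (2.127)"*  (The relation `≦` printed in (2.125) is read `≧`, as (2.126) uses it; b06 records that (2.127) with the
printed constants fails for `L ≥ 10`, `…B6Lemma21Counterexample`-style note in `…B6TreeGaugePoincare`; only the SHAPE of (2.127) — face bonds
bounded by `|(Q₁B)(c)|²`, face plaquettes and in-block bonds, constants depending on `d, L` only — is reproduced here.)

CITATION HEADER (lean-in-tree rule) — WHAT IS REPRODUCED.  Phase-2 file of the `lit-balaban` typed skeleton (HOME
`run/shared/lean/pub/lit-balaban/`), seat **p22 gen 11** (B6 fold owner r03, referee ref-4; lane = the Sect. C chain (2.95)–(2.147) on the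
concrete two-scale data `tsV1`).  SKELETON rows **B6.Eq2.120 / B6.Txt@246** (second step of the printed proof of *"(2.122) ≥ γ₀″‖B‖² on (2.121)"*;
decls of record untouched; r03's `…B6Form2122LowerBound` / `…B6Lemma24Printed` carry the printed (2.124)–(2.128) on ℤ^d with corner blocks).
IMPORTS BY NAME `…B6StairStokesTorus.oc`/`oc_sq_eq` (ordered plaquette variable); `LatticeFieldCalculus.bondAvg`/`segSum`/`runSite` (the `Q₁` of record, (1.11)).  THIS FILE, for a
face `c = ⟨y, y + e_μ⟩` of the unit torus `T^{(j)}` (`j + 1 ≤ m + K`), the face bonds `b_r = ⟨(y, r), μ⟩`, `r_μ = L − 1`, and ONE bound `W` for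
the squares of the in-block bonds of `B(y)`, of `B(y + e_μ)` and of the plaquette variables at `B(y)` (hypotheses `hIn`, `hIn'`, `hC`):
* §1 two elementary inequalities (private); the straight runs across the face are p31's `…BIJ85Eq219Proof.runSite_blockSite_of_lt/_of_ge`
  and `…BIJ85CurlQsstar.shift_blockSite_of_lt/_of_eq`, imported by name;
* §2 (2.124)-shape, one face move: **`face_step_sq_le`** — `|B(b_{r+e_κ}) − B(b_r)|² ≤ 9W` (the move equals a `Δ″`-bond minus a `Δ′`-bond minus
  the plaquette variable between, `face_step_eq`); along a face line `face_line_sq_le` (`≤ 36L²W`); between ANY two face bonds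
  **`face_any_sq_le`** (`≤ 36d²L²W`, comb telescoping over the directions);
* §3 (2.125)-shape: **`segSum_sub_face_sq_le`** — the straight contour `[x, x + Le_μ]` from `x = (y, r)` consists of the face bond `b_{r[μ↦L−1]}`
  and in-block bonds of the two blocks: `|B([x, x + Le_μ]) − B(b_{r[μ↦L−1]})|² ≤ 4L²W`;
* §4 (2.126)–(2.127)-shape: **`face_sq_le_of_bounds`** — `|B(b_g)|² ≤ 3L²|(Q₁B)(c)|² + 120d²L²W` for every face bond (`L^{d+1}(Q₁B)(c) = Σ_x B([x,
  x + Le_μ])`, the face mean against `(Q₁B)(c)`, every face bond against the mean by §2) — and with `W` := (plaquettes at `B(y)`) + (bonds inside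
  `B(y)`) + (bonds inside `B(y + e_μ)`): **`face_sq_le`**, `|B(b_g)|² ≤ 120d²L²(|(Q₁B)(c)|² + Σ_{p₋∈B(y)}|(∂₁B)(p)|² + Σ_{b⊂B(y)}|B(b)|² +
  Σ_{b⊂B(y+e_μ)}|B(b)|²)`.
v1.1 (docfix, ref-4 g29 S-B6-g29-1): the constants quoted in this header now agree with the theorems (`9W`, `36L²W`, `36d²L²W`, `120d²L²`); no Lean change.
THEOREMS ONLY (no definition, no `def … : Prop` fact); standard axioms.  HONEST SCOPE: CONSTANTS OURS and cruder than print (no `(d−1)`-dimensional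
Poincaré inequality: every face bond is compared with the face mean through at most `d(L−1)` face moves, each bounded by the whole `W`); NO GAUGE
CONDITION is used here (the in-block bonds enter as they are; (2.123) or the `Λ^c`-norm bounds them in the assembly `…B6Ineq2122TwoScaleV1`, same
seat); unit lattice factor in `curl`; finite tori of the V1 calculus, centred blocks (`L` odd); NOT summit progress.
-/

noncomputable section

open scoped BigOperators

namespace Literature.MathematicalPhysics.QuantumFieldTheory.Balaban1983to89.B6Ineq2127FaceTorus

open LatticeFieldCalculus B6SectCTwoScaleV1 B6StairStokesTorus B6Ineq2123CentredTorus
open BalabanImbrieJaffe1984to88.BIJ85Eq219Proof (runSite_blockSite_of_lt runSite_blockSite_of_ge)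
open BalabanImbrieJaffe1984to88.BIJ85CurlQsstar (shift_blockSite_of_lt shift_blockSite_of_eq)

variable {P : Params} {j : ℕ}

/-! ## §1  Elementary inequalities -/

/-- `(x + y + z)² ≤ 3(x² + y² + z²)`. [folklore] -/
private theorem sq_add_three_le (x y z : ℝ) : (x + y + z) ^ 2 ≤ 3 * (x ^ 2 + y ^ 2 + z ^ 2) := by
  nlinarith [sq_nonneg (x - y), sq_nonneg (y - z), sq_nonneg (x - z)]

/-- `(x + y)² ≤ 2(x² + y²)`. [folklore] -/
private theorem sq_add_two_le (x y : ℝ) : (x + y) ^ 2 ≤ 2 * (x ^ 2 + y ^ 2) := by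
  nlinarith [sq_nonneg (x - y)]

/-- Cauchy–Schwarz with a uniform bound: `(Σ_{i∈s} f i)² ≤ |s|²·M` when every `f i² ≤ M`. [folklore] -/
private theorem sq_sum_le_card_sq_mul {ι : Type*} (s : Finset ι) (f : ι → ℝ) {M : ℝ} (h : ∀ i ∈ s, f i ^ 2 ≤ M) :
    (∑ i ∈ s, f i) ^ 2 ≤ (s.card : ℝ) ^ 2 * M :=
  calc (∑ i ∈ s, f i) ^ 2 ≤ s.card * ∑ i ∈ s, f i ^ 2 := sq_sum_le_card_mul_sum_sq
    _ ≤ s.card * ∑ _i ∈ s, M := mul_le_mul_of_nonneg_left (Finset.sum_le_sum h) (Nat.cast_nonneg _)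
    _ = (s.card : ℝ) ^ 2 * M := by rw [Finset.sum_const, nsmul_eq_mul]; ring

/-! ## §2  The shape of (2.124): moving a face bond along the face costs a plaquette and two in-block bonds -/

section Face

variable (hj : j + 1 ≤ P.m + P.K) (A : VecField P j ℝ) (y : Site P (j + 1)) (μ : Fin P.d) {W : ℝ} (hW : 0 ≤ W)
  (hIn : ∀ b : PBond P j, blockOf b.src = y → blockOf b.tgt = y → A b ^ 2 ≤ W)
  (hIn' : ∀ b : PBond P j, blockOf b.src = y.shift μ → blockOf b.tgt = y.shift μ → A b ^ 2 ≤ W)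
  (hC : ∀ p : Plaq P j, blockOf p.src = y → curl 1 A p ^ 2 ≤ W)

/-- **one face move, the identity** (the content of (2.124): `(∂B_μ)(b)` for `b = ⟨x, x + e_κ⟩ ⊂ Δ′` equals the plaquette variable of
`p = (x; e_κ, e_μ)` up to the `Δ′`-bond `⟨x, x+e_κ⟩` and the `Δ″`-bond `⟨x+e_μ, x+e_μ+e_κ⟩`):
`B(b_{r+e_κ}) − B(b_r) = B⟨x+e_μ, κ⟩ − B⟨x, κ⟩ + oc B κ μ x`, `x = (y, r)`. [cite: Balaban1984PropagatorsII, (2.124) p.245] -/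
theorem face_step_eq (r : Fin P.d → Fin P.L) {κ : Fin P.d} (hk : (r κ : ℕ) + 1 < P.L) :
    A ⟨Site.blockSite y (Function.update r κ ⟨r κ + 1, hk⟩), μ⟩ - A ⟨Site.blockSite y r, μ⟩ =
      A ⟨(Site.blockSite y r).shift μ, κ⟩ - A ⟨Site.blockSite y r, κ⟩ + oc A κ μ (Site.blockSite y r) := by
  rw [← shift_blockSite_of_lt y r κ hk]
  simp only [oc]
  ring

include hj hIn hIn' hC in
/-- **one face move, the bound**: `|B(b_{r+e_κ}) − B(b_r)|² ≤ 9W` for a face bond `b_r` (`r_μ = L − 1`) and `κ ≠ μ`.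
[cite: Balaban1984PropagatorsII, (2.124) p.245] -/
theorem face_step_sq_le (r : Fin P.d → Fin P.L) (hr : (r μ : ℕ) + 1 = P.L) {κ : Fin P.d} (hκ : κ ≠ μ) (hk : (r κ : ℕ) + 1 < P.L) :
    (A ⟨Site.blockSite y (Function.update r κ ⟨r κ + 1, hk⟩), μ⟩ - A ⟨Site.blockSite y r, μ⟩) ^ 2 ≤ 9 * W := by
  rw [face_step_eq A y μ r hk]
  set s := Site.blockSite y r with hs
  set r₀ : Fin P.d → Fin P.L := Function.update r μ ⟨0, P.L_pos⟩ with hr₀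
  have hr₀κ : (r₀ κ : ℕ) + 1 < P.L := by rw [hr₀, Function.update_of_ne hκ]; exact hk
  have hsμ : s.shift μ = Site.blockSite (y.shift μ) r₀ := shift_blockSite_of_eq hj y r μ hr
  have h1 : A ⟨s.shift μ, κ⟩ ^ 2 ≤ W := by
    apply hIn'
    · rw [hsμ, Site.blockOf_blockSite hj]
    · show blockOf ((s.shift μ).shift κ) = y.shift μ
      rw [hsμ, shift_blockSite_of_lt (y.shift μ) r₀ κ hr₀κ, Site.blockOf_blockSite hj]
  have h2 : A ⟨s, κ⟩ ^ 2 ≤ W := by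
    apply hIn
    · rw [hs, Site.blockOf_blockSite hj]
    · show blockOf (s.shift κ) = y
      rw [hs, shift_blockSite_of_lt y r κ hk, Site.blockOf_blockSite hj]
  have h3 : oc A κ μ s ^ 2 ≤ W := by
    obtain ⟨p, hp, he⟩ := oc_sq_eq A hκ s
    rw [he]
    exact hC p (by rw [hp, hs, Site.blockOf_blockSite hj])
  calc (A ⟨s.shift μ, κ⟩ - A ⟨s, κ⟩ + oc A κ μ s) ^ 2 = (A ⟨s.shift μ, κ⟩ + (-A ⟨s, κ⟩) + oc A κ μ s) ^ 2 := by ring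
    _ ≤ 3 * (A ⟨s.shift μ, κ⟩ ^ 2 + (-A ⟨s, κ⟩) ^ 2 + oc A κ μ s ^ 2) := sq_add_three_le _ _ _
    _ = 3 * (A ⟨s.shift μ, κ⟩ ^ 2 + A ⟨s, κ⟩ ^ 2 + oc A κ μ s ^ 2) := by ring
    _ ≤ 3 * (W + W + W) := by gcongr
    _ = 9 * W := by ring

include hj hW hIn hIn' hC in
/-- **along a face line**: two face bonds differing only in the `κ`-offset, `κ ≠ μ`, satisfy `|B(b) − B(b′)|² ≤ 36L²W` (at most `L − 1` face
moves from the offset `0`, Cauchy–Schwarz). [cite: Balaban1984PropagatorsII, (2.124) p.245] -/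
theorem face_line_sq_le (r : Fin P.d → Fin P.L) (hr : (r μ : ℕ) + 1 = P.L) {κ : Fin P.d} (hκ : κ ≠ μ) (a b : Fin P.L) :
    (A ⟨Site.blockSite y (Function.update r κ a), μ⟩ - A ⟨Site.blockSite y (Function.update r κ b), μ⟩) ^ 2 ≤ 36 * (P.L : ℝ) ^ 2 * W := by
  -- the face bonds along the line, as a function of the natural offset
  set g : ℕ → ℝ := fun t => if h : t < P.L then A ⟨Site.blockSite y (Function.update r κ ⟨t, h⟩), μ⟩ else 0 with hg
  have hstep : ∀ t : ℕ, t + 1 < P.L → (g (t + 1) - g t) ^ 2 ≤ 9 * W := by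
    intro t ht
    have ht' : t < P.L := by omega
    have e1 : g (t + 1) = A ⟨Site.blockSite y (Function.update r κ ⟨t + 1, ht⟩), μ⟩ := by simp only [hg, dif_pos ht]
    have e0 : g t = A ⟨Site.blockSite y (Function.update r κ ⟨t, ht'⟩), μ⟩ := by simp only [hg, dif_pos ht']
    set r₁ : Fin P.d → Fin P.L := Function.update r κ ⟨t, ht'⟩ with hr₁
    have hr₁μ : (r₁ μ : ℕ) + 1 = P.L := by rw [hr₁, Function.update_of_ne (Ne.symm hκ)]; exact hr
    have hr₁κ : (r₁ κ : ℕ) + 1 < P.L := by rw [hr₁, Function.update_self]; exact ht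
    have e2 : Function.update r κ ⟨t + 1, ht⟩ = Function.update r₁ κ ⟨r₁ κ + 1, hr₁κ⟩ := by
      funext ν
      by_cases hν : ν = κ
      · subst hν
        rw [Function.update_self, Function.update_self]
        exact Fin.ext (by simp [hr₁])
      · rw [Function.update_of_ne hν, Function.update_of_ne hν, hr₁, Function.update_of_ne hν]
    rw [e1, e0, e2]
    exact face_step_sq_le hj A y μ hIn hIn' hC r₁ hr₁μ hκ hr₁κ
  have hfrom0 : ∀ a : ℕ, a < P.L → (g a - g 0) ^ 2 ≤ 9 * (P.L : ℝ) ^ 2 * W := by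
    intro a ha
    rw [← Finset.sum_range_sub g a]
    have h1 := sq_sum_le_card_sq_mul (Finset.range a) (fun t => g (t + 1) - g t)
      (fun t ht => hstep t (by have := Finset.mem_range.1 ht; omega))
    rw [Finset.card_range] at h1
    have ha' : (a : ℝ) ^ 2 ≤ (P.L : ℝ) ^ 2 := pow_le_pow_left₀ (Nat.cast_nonneg _) (by exact_mod_cast ha.le) 2
    nlinarith
  have ea : A ⟨Site.blockSite y (Function.update r κ a), μ⟩ = g a := by
    simp only [hg, dif_pos a.isLt, Fin.eta]
  have eb : A ⟨Site.blockSite y (Function.update r κ b), μ⟩ = g b := by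
    simp only [hg, dif_pos b.isLt, Fin.eta]
  rw [ea, eb]
  have ha2 := hfrom0 a a.isLt
  have hb2 := hfrom0 b b.isLt
  calc (g a - g b) ^ 2 = ((g a - g 0) + (-(g b - g 0))) ^ 2 := by ring
    _ ≤ 2 * ((g a - g 0) ^ 2 + (-(g b - g 0)) ^ 2) := sq_add_two_le _ _
    _ = 2 * ((g a - g 0) ^ 2 + (g b - g 0) ^ 2) := by ring
    _ ≤ 2 * (9 * (P.L : ℝ) ^ 2 * W + 9 * (P.L : ℝ) ^ 2 * W) := by gcongr
    _ = 36 * (P.L : ℝ) ^ 2 * W := by ring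

include hj hW hIn hIn' hC in
/-- **between any two face bonds**: `|B(b_r) − B(b_{r′})|² ≤ 36d²L²W` for face bonds `b_r, b_{r′}` of the same face (comb telescoping: change
the offsets one direction at a time, `face_line_sq_le` for each direction `≠ μ`). [cite: Balaban1984PropagatorsII, (2.126) p.245] -/
theorem face_any_sq_le (r r' : Fin P.d → Fin P.L) (hr : (r μ : ℕ) + 1 = P.L) (hr' : (r' μ : ℕ) + 1 = P.L) :
    (A ⟨Site.blockSite y r, μ⟩ - A ⟨Site.blockSite y r', μ⟩) ^ 2 ≤ 36 * (P.d : ℝ) ^ 2 * (P.L : ℝ) ^ 2 * W := by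
  -- the combs between `r′` and `r`
  set h : ℕ → (Fin P.d → Fin P.L) := fun k κ => if (κ : ℕ) < k then r κ else r' κ with hh
  have h0 : h 0 = r' := by funext κ; simp [hh]
  have hd : h P.d = r := by funext κ; simp [hh, κ.isLt]
  have hμ : ∀ k, (h k μ : ℕ) + 1 = P.L := by
    intro k; simp only [hh]; split_ifs; exacts [hr, hr']
  set G : ℕ → ℝ := fun k => A ⟨Site.blockSite y (h k), μ⟩ with hG
  have hstep : ∀ k : ℕ, k < P.d → (G (k + 1) - G k) ^ 2 ≤ 36 * (P.L : ℝ) ^ 2 * W := by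
    intro k hk
    set κ : Fin P.d := ⟨k, hk⟩ with hκ
    have hκv : (κ : ℕ) = k := rfl
    have e1 : h (k + 1) = Function.update (h k) κ (r κ) := by
      funext ν
      by_cases hν : ν = κ
      · subst hν
        rw [Function.update_self]
        simp [hh, hκv]
      · rw [Function.update_of_ne hν]
        have hne : (ν : ℕ) ≠ k := fun e => hν (Fin.ext e)
        simp only [hh]
        by_cases hlt : (ν : ℕ) < k
        · rw [if_pos hlt, if_pos (by omega)]
        · rw [if_neg hlt, if_neg (by omega)]
    have e0 : Function.update (h k) κ (h k κ) = h k := Function.update_eq_self κ (h k)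
    by_cases hκμ : κ = μ
    · -- the face bonds do not depend on the `μ`-offset: both offsets are `L − 1`
      have e2 : h (k + 1) = h k := by
        rw [e1]
        funext ν
        by_cases hν : ν = κ
        · subst hν
          rw [Function.update_self]
          have h1 := hμ k
          have h2 := hr
          rw [← hκμ] at h1 h2
          exact Fin.ext (by omega)
        · rw [Function.update_of_ne hν]
      have e3 : G (k + 1) - G k = 0 := by simp only [hG, e2, sub_self]
      rw [e3, zero_pow two_ne_zero]
      positivity
    · simp only [hG]
      rw [e1]
      have e3 : A ⟨Site.blockSite y (h k), μ⟩ = A ⟨Site.blockSite y (Function.update (h k) κ (h k κ)), μ⟩ := by rw [e0]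
      rw [e3]
      exact face_line_sq_le hj A y μ hW hIn hIn' hC (h k) (hμ k) hκμ (r κ) (h k κ)
  have htel : A ⟨Site.blockSite y r, μ⟩ - A ⟨Site.blockSite y r', μ⟩ = ∑ k ∈ Finset.range P.d, (G (k + 1) - G k) := by
    rw [Finset.sum_range_sub G P.d]
    simp only [hG, h0, hd]
  rw [htel]
  have h1 := sq_sum_le_card_sq_mul (Finset.range P.d) (fun k => G (k + 1) - G k) (fun k hk => hstep k (Finset.mem_range.1 hk))
  rw [Finset.card_range] at h1
  linarith

/-! ## §3  The shape of (2.125): the straight contour `[x, x + Le_μ]` is the face bond plus in-block bonds of the two blocks -/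

include hj hW hIn hIn' in
/-- **`|B([x, x + Le_μ]) − B(b)|² ≤ 4L²W`** for `x = (y, r)` and the face bond `b = b_{r[μ ↦ L−1]}` on its contour: the other `L − 1` bonds of the
contour are the `μ`-bonds `⟨(y, r[μ ↦ r_μ + t]), μ⟩`, `t < L − 1 − r_μ`, inside `B(y)` and `⟨(y + e_μ, r[μ ↦ u]), μ⟩`, `u < r_μ`, inside `B(y + e_μ)`
(the printed decomposition of `L^{−(d+1)}B([x, x + Le_μ])` in (2.125)). [cite: Balaban1984PropagatorsII, (2.125) p.245] -/
theorem segSum_sub_face_sq_le (r : Fin P.d → Fin P.L) (hL1 : P.L - 1 < P.L) :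
    (segSum A (Site.blockSite y r) μ P.L - A ⟨Site.blockSite y (Function.update r μ ⟨P.L - 1, hL1⟩), μ⟩) ^ 2 ≤ 4 * (P.L : ℝ) ^ 2 * W := by
  have ha := (r μ).isLt
  set a : ℕ := (r μ : ℕ) with hadef
  set n₁ : ℕ := P.L - 1 - a with hn₁
  set f : ℕ → ℝ := fun t => A ⟨runSite (Site.blockSite y r) μ t, μ⟩ with hf
  have hseg : segSum A (Site.blockSite y r) μ P.L = ∑ t ∈ Finset.range P.L, f t := rfl
  have hrange : Finset.range P.L = Finset.range (n₁ + 1 + a) := by rw [show n₁ + 1 + a = P.L by omega]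
  have hsplit : ∑ t ∈ Finset.range P.L, f t = ∑ t ∈ Finset.range n₁, f t + f n₁ + ∑ u ∈ Finset.range a, f (n₁ + 1 + u) := by
    rw [hrange, Finset.sum_range_add, Finset.sum_range_succ]
  -- the middle bond is the face bond
  have hmid : f n₁ = A ⟨Site.blockSite y (Function.update r μ ⟨P.L - 1, hL1⟩), μ⟩ := by
    have h1 : (r μ : ℕ) + n₁ < P.L := by omega
    simp only [hf]
    rw [runSite_blockSite_of_lt y r μ h1]
    have e : (⟨(r μ : ℕ) + n₁, h1⟩ : Fin P.L) = ⟨P.L - 1, hL1⟩ := Fin.ext (by show (r μ : ℕ) + n₁ = P.L - 1; omega)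
    rw [e]
  -- the first bonds lie inside `B(y)`
  have hI : ∀ t ∈ Finset.range n₁, f t ^ 2 ≤ W := by
    intro t ht
    have ht' := Finset.mem_range.1 ht
    have h1 : (r μ : ℕ) + t < P.L := by omega
    simp only [hf]
    rw [runSite_blockSite_of_lt y r μ h1]
    apply hIn
    · exact Site.blockOf_blockSite hj y _
    · show blockOf ((Site.blockSite y (Function.update r μ ⟨r μ + t, h1⟩)).shift μ) = y
      rw [shift_blockSite_of_lt y _ μ (by simp only [Function.update_self]; omega), Site.blockOf_blockSite hj]
  -- the last bonds lie inside `B(y + e_μ)`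
  have hJ : ∀ u ∈ Finset.range a, f (n₁ + 1 + u) ^ 2 ≤ W := by
    intro u hu
    have hu' := Finset.mem_range.1 hu
    have h1 : P.L ≤ (r μ : ℕ) + (n₁ + 1 + u) := by omega
    have h2 : (r μ : ℕ) + (n₁ + 1 + u) < 2 * P.L := by omega
    simp only [hf]
    rw [runSite_blockSite_of_ge hj y r μ h1 h2]
    apply hIn'
    · exact Site.blockOf_blockSite hj _ _
    · show blockOf ((Site.blockSite (y.shift μ) (Function.update r μ ⟨r μ + (n₁ + 1 + u) - P.L, _⟩)).shift μ) = y.shift μ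
      rw [shift_blockSite_of_lt (y.shift μ) _ μ (by simp only [Function.update_self]; omega), Site.blockOf_blockSite hj]
  have hIsq : (∑ t ∈ Finset.range n₁, f t) ^ 2 ≤ (P.L : ℝ) ^ 2 * W := by
    have h1 := sq_sum_le_card_sq_mul (Finset.range n₁) f hI
    rw [Finset.card_range] at h1
    have hn : (n₁ : ℝ) ^ 2 ≤ (P.L : ℝ) ^ 2 := pow_le_pow_left₀ (Nat.cast_nonneg _) (by exact_mod_cast (show n₁ ≤ P.L by omega)) 2
    nlinarith
  have hJsq : (∑ u ∈ Finset.range a, f (n₁ + 1 + u)) ^ 2 ≤ (P.L : ℝ) ^ 2 * W := by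
    have h1 := sq_sum_le_card_sq_mul (Finset.range a) (fun u => f (n₁ + 1 + u)) hJ
    rw [Finset.card_range] at h1
    have hn : (a : ℝ) ^ 2 ≤ (P.L : ℝ) ^ 2 := pow_le_pow_left₀ (Nat.cast_nonneg _) (by exact_mod_cast ha.le) 2
    nlinarith
  rw [hseg, hsplit, hmid]
  calc (∑ t ∈ Finset.range n₁, f t + A ⟨Site.blockSite y (Function.update r μ ⟨P.L - 1, hL1⟩), μ⟩ +
        ∑ u ∈ Finset.range a, f (n₁ + 1 + u) - A ⟨Site.blockSite y (Function.update r μ ⟨P.L - 1, hL1⟩), μ⟩) ^ 2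
      = (∑ t ∈ Finset.range n₁, f t + ∑ u ∈ Finset.range a, f (n₁ + 1 + u)) ^ 2 := by ring
    _ ≤ 2 * ((∑ t ∈ Finset.range n₁, f t) ^ 2 + (∑ u ∈ Finset.range a, f (n₁ + 1 + u)) ^ 2) := sq_add_two_le _ _
    _ ≤ 2 * ((P.L : ℝ) ^ 2 * W + (P.L : ℝ) ^ 2 * W) := by gcongr
    _ = 4 * (P.L : ℝ) ^ 2 * W := by ring

/-! ## §4  The shape of (2.126)–(2.127): every face bond against `(Q₁B)(c)` -/

include hj hW hIn hIn' hC in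
/-- **every face bond is controlled by `|(Q₁B)(c)|²`, the face plaquettes and the in-block bonds**: for a face bond `b_g` of `c = ⟨y, y + e_μ⟩`,
`|B(b_g)|² ≤ 3L²|(Q₁B)(c)|² + 120d²L²W` — from `L^{d+1}(Q₁B)(c) = Σ_{x∈B(y)} B([x, x + Le_μ])` ((1.11)/(2.125)), §3 for each contour and §2
between `b_g` and each contour's face bond. [cite: Balaban1984PropagatorsII, (2.127) p.245] -/
theorem face_sq_le_of_bounds (g : Fin P.d → Fin P.L) (hg : (g μ : ℕ) + 1 = P.L) :
    A ⟨Site.blockSite y g, μ⟩ ^ 2 ≤ 3 * (P.L : ℝ) ^ 2 * bondAvg A ⟨y, μ⟩ ^ 2 + 120 * (P.d : ℝ) ^ 2 * (P.L : ℝ) ^ 2 * W := by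
  have hL : (0 : ℝ) < P.L := Nat.cast_pos.2 P.L_pos
  have hL1 : P.L - 1 < P.L := Nat.sub_lt P.L_pos one_pos
  have hLd : (0 : ℝ) < (P.L : ℝ) ^ P.d := pow_pos hL _
  set F := A ⟨Site.blockSite y g, μ⟩ with hF
  set top : (Fin P.d → Fin P.L) → (Fin P.d → Fin P.L) := fun r => Function.update r μ ⟨P.L - 1, hL1⟩ with htop
  have htopμ : ∀ r, ((top r) μ : ℕ) + 1 = P.L := fun r => by simp only [htop, Function.update_self]; omega
  set X : (Fin P.d → Fin P.L) → ℝ := fun r => F - A ⟨Site.blockSite y (top r), μ⟩ with hX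
  set Y : (Fin P.d → Fin P.L) → ℝ := fun r => segSum A (Site.blockSite y r) μ P.L - A ⟨Site.blockSite y (top r), μ⟩ with hY
  have hcard : (Finset.univ : Finset (Fin P.d → Fin P.L)).card = P.L ^ P.d := by
    rw [Finset.card_univ, Fintype.card_fun, Fintype.card_fin, Fintype.card_fin]
  -- `L^{d+1}(Q₁B)(c) = Σ_r B([x_r, x_r + Le_μ])`
  have hQ : ((P.L : ℝ) ^ (P.d + 1)) * bondAvg A ⟨y, μ⟩ = ∑ r : Fin P.d → Fin P.L, segSum A (Site.blockSite y r) μ P.L := by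
    simp only [bondAvg, smul_eq_mul]
    rw [← mul_assoc, mul_inv_cancel₀ (pow_ne_zero _ hL.ne'), one_mul]
  -- `L^d F − L^{d+1}(Q₁B)(c) = Σ_r X_r − Σ_r Y_r`
  have hdec : ((P.L : ℝ) ^ P.d) * F = ((P.L : ℝ) ^ (P.d + 1)) * bondAvg A ⟨y, μ⟩ + ∑ r, X r - ∑ r, Y r := by
    rw [hQ]
    simp only [hX, hY, Finset.sum_sub_distrib, Finset.sum_const, hcard, nsmul_eq_mul]
    push_cast
    ring
  have hXb : ∀ r, X r ^ 2 ≤ 36 * (P.d : ℝ) ^ 2 * (P.L : ℝ) ^ 2 * W := fun r =>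
    face_any_sq_le hj A y μ hW hIn hIn' hC g (top r) hg (htopμ r)
  have hYb : ∀ r, Y r ^ 2 ≤ 4 * (P.L : ℝ) ^ 2 * W := fun r => segSum_sub_face_sq_le hj A y μ hW hIn hIn' r hL1
  have hcard' : ((Finset.univ : Finset (Fin P.d → Fin P.L)).card : ℝ) ^ 2 = (P.L : ℝ) ^ P.d * (P.L : ℝ) ^ P.d := by
    rw [hcard]; push_cast; ring
  have hXs : (∑ r, X r) ^ 2 ≤ (P.L : ℝ) ^ P.d * ((P.L : ℝ) ^ P.d * (36 * (P.d : ℝ) ^ 2 * (P.L : ℝ) ^ 2 * W)) := by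
    have h1 := sq_sum_le_card_sq_mul Finset.univ X (fun r _ => hXb r)
    rw [hcard', mul_assoc] at h1
    exact h1
  have hYs : (∑ r, Y r) ^ 2 ≤ (P.L : ℝ) ^ P.d * ((P.L : ℝ) ^ P.d * (4 * (P.L : ℝ) ^ 2 * W)) := by
    have h1 := sq_sum_le_card_sq_mul Finset.univ Y (fun r _ => hYb r)
    rw [hcard', mul_assoc] at h1
    exact h1
  have hmain : ((P.L : ℝ) ^ P.d) ^ 2 * F ^ 2 ≤ ((P.L : ℝ) ^ P.d) ^ 2 *
      (3 * (P.L : ℝ) ^ 2 * bondAvg A ⟨y, μ⟩ ^ 2 + 120 * (P.d : ℝ) ^ 2 * (P.L : ℝ) ^ 2 * W) := by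
    have hd1 : (1 : ℝ) ≤ (P.d : ℝ) ^ 2 := by
      have : (1 : ℝ) ≤ P.d := by exact_mod_cast P.hd
      nlinarith
    calc ((P.L : ℝ) ^ P.d) ^ 2 * F ^ 2 = (((P.L : ℝ) ^ (P.d + 1)) * bondAvg A ⟨y, μ⟩ + ∑ r, X r + (-∑ r, Y r)) ^ 2 := by
          rw [← mul_pow, hdec]; ring
      _ ≤ 3 * ((((P.L : ℝ) ^ (P.d + 1)) * bondAvg A ⟨y, μ⟩) ^ 2 + (∑ r, X r) ^ 2 + (-∑ r, Y r) ^ 2) := sq_add_three_le _ _ _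
      _ = 3 * ((((P.L : ℝ) ^ (P.d + 1)) * bondAvg A ⟨y, μ⟩) ^ 2 + (∑ r, X r) ^ 2 + (∑ r, Y r) ^ 2) := by ring
      _ ≤ 3 * ((((P.L : ℝ) ^ (P.d + 1)) * bondAvg A ⟨y, μ⟩) ^ 2 + (P.L : ℝ) ^ P.d * ((P.L : ℝ) ^ P.d * (36 * (P.d : ℝ) ^ 2 * (P.L : ℝ) ^ 2 * W))
            + (P.L : ℝ) ^ P.d * ((P.L : ℝ) ^ P.d * (4 * (P.L : ℝ) ^ 2 * W))) := by gcongr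
      _ = ((P.L : ℝ) ^ P.d) ^ 2 * (3 * (P.L : ℝ) ^ 2 * bondAvg A ⟨y, μ⟩ ^ 2 + (108 * (P.d : ℝ) ^ 2 + 12) * (P.L : ℝ) ^ 2 * W) := by ring
      _ ≤ ((P.L : ℝ) ^ P.d) ^ 2 * (3 * (P.L : ℝ) ^ 2 * bondAvg A ⟨y, μ⟩ ^ 2 + 120 * (P.d : ℝ) ^ 2 * (P.L : ℝ) ^ 2 * W) := by
          have h12 : (108 * (P.d : ℝ) ^ 2 + 12) * (P.L : ℝ) ^ 2 * W ≤ 120 * (P.d : ℝ) ^ 2 * (P.L : ℝ) ^ 2 * W := by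
            have : (108 * (P.d : ℝ) ^ 2 + 12) ≤ 120 * (P.d : ℝ) ^ 2 := by nlinarith
            exact mul_le_mul_of_nonneg_right (mul_le_mul_of_nonneg_right this (sq_nonneg _)) hW
          gcongr ((P.L : ℝ) ^ P.d) ^ 2 * (3 * (P.L : ℝ) ^ 2 * bondAvg A ⟨y, μ⟩ ^ 2 + ?_)
  exact le_of_mul_le_mul_left hmain (pow_pos hLd 2)

include hj in
/-- **the face estimate** (shape of (2.127), constants ours): for every bond `b` crossing the face `c = ⟨y, y + e_μ⟩` from `B(y)` to `B(y + e_μ)`,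
`|B(b)|² ≤ 120d²L²(|(Q₁B)(c)|² + Σ_{p : p₋∈B(y)}|(∂₁B)(p)|² + Σ_{b′⊂B(y)}|B(b′)|² + Σ_{b′⊂B(y+e_μ)}|B(b′)|²)` — no gauge condition used.
[cite: Balaban1984PropagatorsII, (2.127) p.245] -/
theorem face_sq_le (A : VecField P j ℝ) (y : Site P (j + 1)) (μ : Fin P.d) (g : Fin P.d → Fin P.L) (hg : (g μ : ℕ) + 1 = P.L) :
    A ⟨Site.blockSite y g, μ⟩ ^ 2 ≤ 120 * (P.d : ℝ) ^ 2 * (P.L : ℝ) ^ 2 *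
      (bondAvg A ⟨y, μ⟩ ^ 2 + (∑ p ∈ Finset.univ.filter (fun p : Plaq P j => blockOf p.src = y), curl 1 A p ^ 2)
        + (∑ b ∈ Finset.univ.filter (fun b : PBond P j => blockOf b.src = y ∧ blockOf b.tgt = y), A b ^ 2)
        + (∑ b ∈ Finset.univ.filter (fun b : PBond P j => blockOf b.src = y.shift μ ∧ blockOf b.tgt = y.shift μ), A b ^ 2)) := by
  classical
  set Cu := ∑ p ∈ Finset.univ.filter (fun p : Plaq P j => blockOf p.src = y), curl 1 A p ^ 2 with hCu
  set I₁ := ∑ b ∈ Finset.univ.filter (fun b : PBond P j => blockOf b.src = y ∧ blockOf b.tgt = y), A b ^ 2 with hI₁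
  set I₂ := ∑ b ∈ Finset.univ.filter (fun b : PBond P j => blockOf b.src = y.shift μ ∧ blockOf b.tgt = y.shift μ), A b ^ 2 with hI₂
  have hCu0 : 0 ≤ Cu := Finset.sum_nonneg fun _ _ => sq_nonneg _
  have hI₁0 : 0 ≤ I₁ := Finset.sum_nonneg fun _ _ => sq_nonneg _
  have hI₂0 : 0 ≤ I₂ := Finset.sum_nonneg fun _ _ => sq_nonneg _
  set W := Cu + I₁ + I₂ with hWdef
  have hW : 0 ≤ W := by positivity
  have hIn : ∀ b : PBond P j, blockOf b.src = y → blockOf b.tgt = y → A b ^ 2 ≤ W := by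
    intro b h1 h2
    have hm : b ∈ Finset.univ.filter (fun b : PBond P j => blockOf b.src = y ∧ blockOf b.tgt = y) :=
      Finset.mem_filter.2 ⟨Finset.mem_univ _, h1, h2⟩
    exact (Finset.single_le_sum (f := fun b : PBond P j => A b ^ 2) (fun _ _ => sq_nonneg _) hm).trans (by rw [hWdef]; linarith)
  have hIn' : ∀ b : PBond P j, blockOf b.src = y.shift μ → blockOf b.tgt = y.shift μ → A b ^ 2 ≤ W := by
    intro b h1 h2
    have hm : b ∈ Finset.univ.filter (fun b : PBond P j => blockOf b.src = y.shift μ ∧ blockOf b.tgt = y.shift μ) :=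
      Finset.mem_filter.2 ⟨Finset.mem_univ _, h1, h2⟩
    exact (Finset.single_le_sum (f := fun b : PBond P j => A b ^ 2) (fun _ _ => sq_nonneg _) hm).trans (by rw [hWdef]; linarith)
  have hC : ∀ p : Plaq P j, blockOf p.src = y → curl 1 A p ^ 2 ≤ W := fun p h1 =>
    (Finset.single_le_sum (f := fun p : Plaq P j => curl 1 A p ^ 2) (fun _ _ => sq_nonneg _)
      (Finset.mem_filter.2 ⟨Finset.mem_univ _, h1⟩)).trans (by rw [hWdef]; linarith)
  have h := face_sq_le_of_bounds hj A y μ hW hIn hIn' hC g hg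
  have hd1 : (1 : ℝ) ≤ (P.d : ℝ) ^ 2 := by
    have : (1 : ℝ) ≤ P.d := by exact_mod_cast P.hd
    nlinarith
  have hb0 : 0 ≤ (P.L : ℝ) ^ 2 * bondAvg A ⟨y, μ⟩ ^ 2 := by positivity
  calc A ⟨Site.blockSite y g, μ⟩ ^ 2 ≤ 3 * (P.L : ℝ) ^ 2 * bondAvg A ⟨y, μ⟩ ^ 2 + 120 * (P.d : ℝ) ^ 2 * (P.L : ℝ) ^ 2 * W := h
    _ ≤ 120 * (P.d : ℝ) ^ 2 * ((P.L : ℝ) ^ 2 * bondAvg A ⟨y, μ⟩ ^ 2) + 120 * (P.d : ℝ) ^ 2 * (P.L : ℝ) ^ 2 * W := by nlinarith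
    _ = 120 * (P.d : ℝ) ^ 2 * (P.L : ℝ) ^ 2 * (bondAvg A ⟨y, μ⟩ ^ 2 + Cu + I₁ + I₂) := by rw [hWdef]; ring

end Face


end Literature.MathematicalPhysics.QuantumFieldTheory.Balaban1983to89.B6Ineq2127FaceTorus

end
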